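import Literature.IUT.HodgeTheaters.GaloisValDatumGenuineBaseIso
import Literature.AlgebraicGeometry.Frobenioids.PadicFrobenioidPerfectionBaseIso
import Literature.IUT.HodgeTheaters.Cor53iiAtGoodPlaceOfEndUnits
import Literature.IUT.HodgeTheaters.GoodLocalFrobenioidOfGaloisDdash
import Literature.AnabelianGeometry.SemiGraphs.TemperedGroups
import HarnessLib

/-!
# [IUTchI] Cor 5.3 (ii) at the GENUINE good non-archimedean place: INJECTIVITY of `Aut(𝒞_v̲) → Aut(𝒟_v̲)` WITHOUT the law
# `hO` — the junction J-C53-BASE-ISO knit (J1 + J2 + J3 by name)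

S. Mochizuki, *Inter-universal Teichmüller theory I*, kurims manuscript (May 2020), §5 Corollary 5.3 (ii) p. 144 l. 14–18
(«the natural map `Isom(¹𝔉, ²𝔉) → Isom(¹𝔇, ²𝔇)` … is bijective»), proof p. 144 l. 33–36 («Assertion (ii) … follows immediately
from [AbsTopIII], Proposition 3.2, (iv); [AbsTopIII], Proposition 4.2, (i) …»); Example 3.3 (i) p. 78 ([IUTchI] Cor 5.3 (ii) p.144)
[claim: Mochizuki2012, status: disputed] (D-0012 claim key; nothing of the series is asserted; no side is taken on [IUTchIII]
Cor. 3.12).  S. Mochizuki, *The geometry of Frobenioids II*, Kyushu J. Math. **62** (2008), Ex. 1.1 (ii) p. 8, Ex. 1.3 (iii) pp. 11–12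
[cite: MochizukiFrdII2008, Ex 1.3 (iii) pp.11-12]; S. Mochizuki, *Semi-graphs of anabelioids*, Rmk 3.1.1 p. 33 («every profinite
group is tempered») [cite: MochizukiSemiAnbd2006, Rmk 3.1.1 p.33].

PROOF-ONLY knit (cell abc-iut; seat abc-iut-L1-t7 gen 10; sequel of abc-iut-L1-d6's `Cor53iiAtGoodPlaceOfEndUnits` ★ p504853, whose
§3 closers carry the ONE law `hO`).  The law is now a THEOREM on this path: abc-iut-L1-t7's `PadicFrd.Datum.hker_genuine` (★ p504140)
proves kernel triviality at every genuine §2 base, abc-iut-L1-t4's `PadicFrd.Datum.perf_hker_of_baseIso_genuine` (★ p509637; J2 + J3)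
transports it along any isomorphism of base functors, and abc-iut-L1-t7's `GaloisValDatum.exists_isOpenHom_galoisBaseV_iso_genuine`
(★ p510148; J1) supplies that isomorphism for the datum `GaloisValDatum.ofComplete p k`:
* §1 `Cor53.perf_galoisBaseV_ofComplete_hker` — the `hker` binder of abc-iut-L5-t4's `Cor53.cosetCat_descend_injective_of_kernel_trivial`
  at `Q := Datum.perf (galoisBaseV (ofComplete p k) aug ho) …` HOLDS, binders {`[SecondCountableTopology Π]`, `hG : IsTempered Π`,
  `hZ : IsSlimGroup Π`, `hsl : IsSlim (CosetCat Π)`, `hc : Continuous aug`, `ho : IsOpenMap aug`} — NO law;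
* §2 at the REAL `GoodLocalFrobenioid.ofGalois (ofComplete p k) aug …`: `Cor53.ofGalois_ofComplete_descend_injective` and (print's
  «bijective») `…_descendBijective_of_lifts` — p504853's §3 shapes with `hO` DROPPED;
* §3 at the GENUINE PLACE `D.goodLocalFrobenioidOfEmb p k ι hX` of the initial Θ-data (`Π_v̲ := Π_{X̲→_v̲}`):
  `Cor53.goodLocalFrobenioidOfEmb_descend_injective_of_geom_slim'` / `…_of_geomAndArithSlim'` — INJECTIVITY modulo ONLY
  {F-0004 (1) `IsSlimGroup Δ_C`, Galois-countability `[SecondCountableTopology Π_v̲]`} and the inhabited §0 binders {he, hu}: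
  `Π_v̲` is tempered because it is profinite (`IsTempered.of_profinite`: compact by abc-iut-L5-t2's `compactSpace_PiLoc`, totally
  disconnected inside `Π_{C_F} × Gal(k̄/k)`), temp-slim by `isSlimGroup_PiLoc_PiXarrow_of_geom_slim`, and `ℬ(Π_v̲)⁰` slim by
  `PadicFrd.isSlim_cosetCat_of_isSlimGroup`; and `…_descendBijective_of_lifts_of_geom_slim` (bijective modulo additionally FACT {hlift}).
* §4 (v2) Galois-countability BY NAME: `GaloisValDatum.secondCountableTopology_gal_ofComplete` — `Gal(k̄/k)` is Galois-countable for
  EVERY `k` finite over `ℚ_p` (closed embedding `ψ_e` into the Galois-countable `G_{ℚ_p}`; no density hypothesis), whence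
  `InitialThetaData.secondCountableTopology_PiLoc_PiXarrow_of_PiC` / `…_of_tameGaloisCountable` and the closers
  `Cor53.goodLocalFrobenioidOfEmb_descend_injective_of_geom_slim_of_PiC` (side binder = the cell-standard `[SecondCountableTopology Π_{C_F}]`)
  and `Cor53.goodLocalFrobenioidOfEmb_descend_injective_of_facts` / `…_descendBijective_of_lifts_of_facts` — INJECTIVITY at the
  genuine place modulo ONLY the frozen FACTS {F-1979 (E2) `Rmk253.TameGaloisCountable`, F-0004 `GeomAndArithSlim`} and {he, hu}: LAW ∅, side ∅.
No definition, instance, notation or `Prop` fact; nothing of the consumed files is restated; typed ≠ proved for hlift / F-0004 / F-1979;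
nothing here bears on [IUTchIII] Cor. 3.12.
-/

-- `GoodLocalFrobenioid.ofGalois` fields / `GaloisValDatum.ofComplete` unfold only at default transparency.
set_option backward.isDefEq.respectTransparency false

namespace Literature.IUT.HodgeTheaters

open CategoryTheory Opposite Literature.AlgebraicGeometry.Frobenioids Literature.AnabelianGeometry.SemiGraphs
open Literature.AlgebraicGeometry.Frobenioids.PadicFrd Literature.AnabelianGeometry.AbsoluteAnabelian QuasiTemperoid

namespace Cor53

/-! ### §1. `hker` at `Q := Datum.perf (galoisBaseV (ofComplete p k) aug ho)` — the law `hO` replaced by the junction -/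

section Perf

variable (p : ℕ) [Fact p.Prime] (k : Type) [NontriviallyNormedField k] [CompleteSpace k] [IsUltrametricDist k]
  [NormedAlgebra ℚ_[p] k] [FiniteDimensional ℚ_[p] k] {P : Type} [Group P] [TopologicalSpace P] [IsTopologicalGroup P]
  [SecondCountableTopology P] (hG : IsTempered P) (hZ : IsSlimGroup P)
  (aug : P →* (AlgebraicClosure k ≃ₐ[k] AlgebraicClosure k)) (hc : Continuous aug) (ho : IsOpenMap aug)
  (hsl : IsSlim (CosetCat P))

include hG hZ hc hsl in
/-- **Kernel triviality at the `p`-adic Frobenioid UNDER L5's real carrier, genuine datum `ofComplete p k`, NO law.**  Every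
self-equivalence of `Q := Datum.perf (galoisBaseV (ofComplete p k) aug ho) …` (`Φ_{𝒞_v} = ord(𝒪^▷)^pf`, [IUTchI] Ex. 3.3 (i)) lying
over the identity of `ℬ(Π_v)⁰` is `≅ 𝟭`: J1 (`exists_isOpenHom_galoisBaseV_iso_genuine`) gives an open `φ₁ : Π_v → G_{ℚ_p}` and
`eb : galoisBaseV ≅` (genuine base of `φ₁`), and abc-iut-L1-t4's `Datum.perf_hker_of_baseIso_genuine` transports abc-iut-L1-t7's
`Datum.hker_genuine` along `eb`.  Binders: `Π_v` tempered, temp-slim, Galois-countable; `ℬ(Π_v)⁰` slim; `aug` continuous open.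
([IUTchI] Cor 5.3 (ii) p.144) [claim: Mochizuki2012, status: disputed] -/
theorem perf_galoisBaseV_ofComplete_hker :
    ∀ Ψ : (Datum.perf (GoodLocalFrobenioid.galoisBaseV (GaloisValDatum.ofComplete p k) aug ho)
          (GoodLocalFrobenioid.galoisBaseV_isPadicLocal (GaloisValDatum.ofComplete p k) aug ho)
          CosetCat.isConnected CosetCat.isTotallyEpimorphic).frobenioid ≌
        (Datum.perf (GoodLocalFrobenioid.galoisBaseV (GaloisValDatum.ofComplete p k) aug ho)
          (GoodLocalFrobenioid.galoisBaseV_isPadicLocal (GaloisValDatum.ofComplete p k) aug ho)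
          CosetCat.isConnected CosetCat.isTotallyEpimorphic).frobenioid,
      Nonempty (CatIsomorphism.LiesUnder
        (ModelFrobenioid.baseFunctor
          (Datum.perf (GoodLocalFrobenioid.galoisBaseV (GaloisValDatum.ofComplete p k) aug ho)
            (GoodLocalFrobenioid.galoisBaseV_isPadicLocal (GaloisValDatum.ofComplete p k) aug ho)
            CosetCat.isConnected CosetCat.isTotallyEpimorphic).Φ
          (Datum.perf (GoodLocalFrobenioid.galoisBaseV (GaloisValDatum.ofComplete p k) aug ho)
            (GoodLocalFrobenioid.galoisBaseV_isPadicLocal (GaloisValDatum.ofComplete p k) aug ho)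
            CosetCat.isConnected CosetCat.isTotallyEpimorphic).B
          (Datum.perf (GoodLocalFrobenioid.galoisBaseV (GaloisValDatum.ofComplete p k) aug ho)
            (GoodLocalFrobenioid.galoisBaseV_isPadicLocal (GaloisValDatum.ofComplete p k) aug ho)
            CosetCat.isConnected CosetCat.isTotallyEpimorphic).divB)
        (ModelFrobenioid.baseFunctor
          (Datum.perf (GoodLocalFrobenioid.galoisBaseV (GaloisValDatum.ofComplete p k) aug ho)
            (GoodLocalFrobenioid.galoisBaseV_isPadicLocal (GaloisValDatum.ofComplete p k) aug ho)
            CosetCat.isConnected CosetCat.isTotallyEpimorphic).Φ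
          (Datum.perf (GoodLocalFrobenioid.galoisBaseV (GaloisValDatum.ofComplete p k) aug ho)
            (GoodLocalFrobenioid.galoisBaseV_isPadicLocal (GaloisValDatum.ofComplete p k) aug ho)
            CosetCat.isConnected CosetCat.isTotallyEpimorphic).B
          (Datum.perf (GoodLocalFrobenioid.galoisBaseV (GaloisValDatum.ofComplete p k) aug ho)
            (GoodLocalFrobenioid.galoisBaseV_isPadicLocal (GaloisValDatum.ofComplete p k) aug ho)
            CosetCat.isConnected CosetCat.isTotallyEpimorphic).divB)
        Ψ (CategoryTheory.Equivalence.refl (C := CosetCat P))) →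
      Nonempty (Ψ.functor ≅ 𝟭 _) := by
  obtain ⟨φ₁, hφ₁, ⟨eb⟩⟩ := GaloisValDatum.exists_isOpenHom_galoisBaseV_iso_genuine p k aug hc ho
  exact Datum.perf_hker_of_baseIso_genuine hG hZ φ₁ hφ₁ hsl _ _ _ _ eb

end Perf

/-! ### §2. At the REAL `GoodLocalFrobenioid.ofGalois (ofComplete p k) aug …`: injectivity / bijectivity, `hO` dropped -/

section OfGalois

variable (p : ℕ) [Fact p.Prime] (k : Type) [NontriviallyNormedField k] [CompleteSpace k] [IsUltrametricDist k]
  [NormedAlgebra ℚ_[p] k] [FiniteDimensional ℚ_[p] k] {P : Type} [Group P] [TopologicalSpace P] [IsTopologicalGroup P]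
  [SecondCountableTopology P] (hG : IsTempered P) (hZ : IsSlimGroup P)
  (aug : P →* (AlgebraicClosure k ≃ₐ[k] AlgebraicClosure k)) (hc : Continuous aug) (hs : Function.Surjective aug)
  (ho : IsOpenMap aug) (Kv : Type) [Field Kv] [ValuativeRel Kv] (hp : ((p : Kv)) ∈ PadicFrd.intNonzero Kv)
  (hsl : IsSlim (CosetCat P))

include hG hZ in
/-- **Cor 5.3 (ii) model case, INJECTIVITY, at the REAL `𝒞_v = (ofGalois (ofComplete p k) aug …).Cv` over `𝒟_v = ℬ(Π_v)⁰`**, the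
law `hO` of p504853's `ofGalois_descend_injective_of_endUnits` DISCHARGED by the junction (§1): modulo {`IsSlim (CosetCat Π_v)`,
`Π_v` tempered · temp-slim · Galois-countable} the natural map `Aut(𝒞_v) → Aut(𝒟_v)` is injective.
([IUTchI] Cor 5.3 (ii) p.144) [claim: Mochizuki2012, status: disputed] -/
theorem ofGalois_ofComplete_descend_injective :
    Function.Injective (CatIsomorphism.descend
      (GoodLocalFrobenioid.hasUnder_toBase_ofGalois (GaloisValDatum.ofComplete p k) aug hc hs ho Kv hp
        (GaloisValDatum.ofComplete p k) aug hc hs ho Kv hp hsl hsl)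
      (GoodLocalFrobenioid.underUnique_toBase_ofGalois (GaloisValDatum.ofComplete p k) aug hc hs ho Kv hp
        (GaloisValDatum.ofComplete p k) aug hc hs ho Kv hp hsl hsl)) :=
  CatIsomorphism.descend_injective_of_kernel_trivial _ _ (perf_galoisBaseV_ofComplete_hker p k hG hZ aug hc ho hsl)

include hG hZ in
/-- **Cor 5.3 (ii) model case AS PRINTED («bijective») at the REAL `𝒞_v = (ofGalois (ofComplete p k) aug …).Cv`**, modulo
{`IsSlim (CosetCat Π_v)`, `Π_v` tempered · temp-slim · Galois-countable} (injectivity, NO law) + FACT {hlift} (surjectivity: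
[AbsTopIII] Prop 3.2 (iv) through the construction — BY NAME). ([IUTchI] Cor 5.3 (ii) p.144) [claim: Mochizuki2012, status: disputed] -/
theorem ofGalois_ofComplete_descendBijective_of_lifts
    (hlift : ∀ Θ : CosetCat P ≌ CosetCat P,
      ∃ Ψ : (GoodLocalFrobenioid.ofGalois (GaloisValDatum.ofComplete p k) aug hc hs ho Kv hp).Cv ≌
          (GoodLocalFrobenioid.ofGalois (GaloisValDatum.ofComplete p k) aug hc hs ho Kv hp).Cv,
        Nonempty (CatIsomorphism.LiesUnder (GoodLocalFrobenioid.ofGalois (GaloisValDatum.ofComplete p k) aug hc hs ho Kv hp).toBase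
          (GoodLocalFrobenioid.ofGalois (GaloisValDatum.ofComplete p k) aug hc hs ho Kv hp).toBase Ψ Θ)) :
    CatIsomorphism.DescendBijective (GoodLocalFrobenioid.ofGalois (GaloisValDatum.ofComplete p k) aug hc hs ho Kv hp).toBase
      (GoodLocalFrobenioid.ofGalois (GaloisValDatum.ofComplete p k) aug hc hs ho Kv hp).toBase
      (GoodLocalFrobenioid.hasUnder_toBase_ofGalois (GaloisValDatum.ofComplete p k) aug hc hs ho Kv hp
        (GaloisValDatum.ofComplete p k) aug hc hs ho Kv hp hsl hsl)
      (GoodLocalFrobenioid.underUnique_toBase_ofGalois (GaloisValDatum.ofComplete p k) aug hc hs ho Kv hp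
        (GaloisValDatum.ofComplete p k) aug hc hs ho Kv hp hsl hsl) :=
  ⟨ofGalois_ofComplete_descend_injective p k hG hZ aug hc hs ho Kv hp hsl,
    CatIsomorphism.descend_surjective_of_lifts _ _ hlift⟩

end OfGalois

/-! ### §3. At the GENUINE PLACE `v̲ ∈ V̲^good ∩ V̲^non` of the initial Θ-data: injectivity modulo F-0004 (1) + Galois-countability -/

section GenuinePlace

universe uF vK

variable {F : Type uF} {K : Type vK} {Fbar : Type} [Field F] [NumberField F] [Field K] [NumberField K]
  [Algebra F K] [Field Fbar] [Algebra F Fbar] [Algebra K Fbar] [IsScalarTower F K Fbar] [Normal K Fbar]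
  {E : WeierstrassCurve F} [E.IsElliptic] {l : ℕ} {Pb : BadPlacePredicates K}
  (D : InitialThetaData F K Fbar E l Pb) (p : ℕ) [Fact p.Prime]
  (k : Type) [NontriviallyNormedField k] [CompleteSpace k] [IsUltrametricDist k] [NormedAlgebra ℚ_[p] k]
  [FiniteDimensional ℚ_[p] k] [Algebra K k] (ι : Fbar →ₐ[K] AlgebraicClosure k) (hX : IsOpen (D.PiXarrow : Set D.PiC))

omit [CompleteSpace k] [IsUltrametricDist k] [FiniteDimensional ℚ_[p] k] in
include p hX in
/-- **`Π_v̲ := Π_{X̲→_v̲}` is tempered** — it is PROFINITE («every profinite group is tempered», [SemiAnbd] Rmk 3.1.1;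
`IsTempered.of_profinite`): compact by abc-iut-L5-t2's `compactSpace_PiLoc` (`Π_{X̲→_K}` open, `Gal(k̄/k) → G_F` continuous), totally
disconnected as a closed subgroup of `Π_{C_F} × Gal(k̄/k)`. [cite: MochizukiSemiAnbd2006, Rmk 3.1.1 p.33] -/
theorem isTempered_PiLoc_PiXarrow : IsTempered (D.PiLoc D.PiXarrow (localToGF F k ι)) := by
  haveI := GaloisValDatum.charZero p k
  haveI : Algebra.IsIntegral k (AlgebraicClosure k) := Algebra.isAlgebraic_iff_isIntegral.mp inferInstance
  haveI : CompactSpace (D.PiLoc D.PiXarrow (localToGF F k ι)) :=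
    D.compactSpace_PiLoc D.PiXarrow (localToGF F k ι) hX (continuous_localToGF F k ι)
  exact IsTempered.of_profinite

/-- **[IUTchI] Cor 5.3 (ii), model case, INJECTIVITY, AT THE GENUINE PLACE `v̲ ∈ V̲^good ∩ V̲^non` of the initial Θ-data**
(`𝒞_v̲ := (D.goodLocalFrobenioidOfEmb p k ι hX).Cv` over `𝒟_v̲ = ℬ(Π_v̲)⁰`, every `K`-embedding `ι : F̄ → k̄`) — the LAW `hO` of
p504853's `goodLocalFrobenioidOfEmb_descend_injective_of_endUnits_of_geom_slim` is GONE: modulo ONLY the slimness of `Δ_C` (F-0004 (1),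
[AbsAnab] Lem. 1.3.1) and the Galois-countability of `Π_v̲`, for EVERY choice of the §0 binders `he`/`hu`, the natural map
`Aut(𝒞_v̲) → Aut(𝒟_v̲)` is injective.  Binder census: FACT-input {`IsSlimGroup D.DeltaC` = F-0004 (1)} · side {`SecondCountableTopology Π_v̲`}
· binders {he, hu} (inhabited, abc-iut-w4-d109) · DATA {D, p, k, ι, hX} · LAW ∅. ([IUTchI] Cor 5.3 (ii) p.144) [claim: Mochizuki2012, status: disputed] -/
theorem goodLocalFrobenioidOfEmb_descend_injective_of_geom_slim'
    [SecondCountableTopology (D.PiLoc D.PiXarrow (localToGF F k ι))] (hΔ : IsSlimGroup D.DeltaC)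
    (he : letI := GaloisValDatum.normVal k
      CatIsomorphism.HasUnder (D.goodLocalFrobenioidOfEmb p k ι hX).toBase (D.goodLocalFrobenioidOfEmb p k ι hX).toBase)
    (hu : letI := GaloisValDatum.normVal k
      CatIsomorphism.UnderUnique (D.goodLocalFrobenioidOfEmb p k ι hX).toBase (D.goodLocalFrobenioidOfEmb p k ι hX).toBase) :
    Function.Injective (CatIsomorphism.descend he hu) := by
  letI := GaloisValDatum.normVal k
  haveI := GaloisValDatum.charZero p k
  haveI : CompactSpace (D.PiLoc D.PiXarrow (localToGF F k ι)) :=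
    D.compactSpace_PiLoc D.PiXarrow (localToGF F k ι) hX (continuous_localToGF F k ι)
  have hZ : IsSlimGroup (D.PiLoc D.PiXarrow (localToGF F k ι)) := D.isSlimGroup_PiLoc_PiXarrow_of_geom_slim p k hΔ ι hX
  exact CatIsomorphism.descend_injective_of_kernel_trivial he hu
    (perf_galoisBaseV_ofComplete_hker p k (isTempered_PiLoc_PiXarrow D p k ι hX) hZ _
      (D.continuous_augLoc D.PiXarrow (localToGF F k ι))
      (D.isOpenMap_augLoc D.PiXarrow (localToGF F k ι) hX (continuous_localToGF F k ι))
      (PadicFrd.isSlim_cosetCat_of_isSlimGroup hZ))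

/-- **F-0004 BY NAME**: the same consuming the frozen fact `GeomAndArithSlim D.geom.extF` ([AbsAnab] Lem. 1.3.1 «`Δ`, `Π` slim»;
only its first conjunct is used).  Binder census: FACT {F-0004} · side {`SecondCountableTopology Π_v̲`} · binders {he, hu} · LAW ∅.
([IUTchI] Cor 5.3 (ii) p.144) [claim: Mochizuki2012, status: disputed] -/
theorem goodLocalFrobenioidOfEmb_descend_injective_of_geomAndArithSlim'
    [SecondCountableTopology (D.PiLoc D.PiXarrow (localToGF F k ι))]
    (h : Literature.AnabelianGeometry.AbsoluteAnabelian.FundamentalExtension.GeomAndArithSlim D.geom.extF)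
    (he : letI := GaloisValDatum.normVal k
      CatIsomorphism.HasUnder (D.goodLocalFrobenioidOfEmb p k ι hX).toBase (D.goodLocalFrobenioidOfEmb p k ι hX).toBase)
    (hu : letI := GaloisValDatum.normVal k
      CatIsomorphism.UnderUnique (D.goodLocalFrobenioidOfEmb p k ι hX).toBase (D.goodLocalFrobenioidOfEmb p k ι hX).toBase) :
    Function.Injective (CatIsomorphism.descend he hu) :=
  goodLocalFrobenioidOfEmb_descend_injective_of_geom_slim' D p k ι hX h.1 he hu

/-- **[IUTchI] Cor 5.3 (ii), model case AS PRINTED («bijective»), AT THE GENUINE PLACE**, for every choice of the §0 binders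
`he`/`hu`: modulo {F-0004 (1), Galois-countability of `Π_v̲`} (injectivity, NO law) + FACT {hlift} (surjectivity: [AbsTopIII]
Prop 3.2 (iv) through the construction — BY NAME).  Binder census: FACT-input {`IsSlimGroup D.DeltaC`} · side {`SecondCountableTopology
Π_v̲`} · FACT {hlift} · binders {he, hu} · LAW ∅. ([IUTchI] Cor 5.3 (ii) p.144) [claim: Mochizuki2012, status: disputed] -/
theorem goodLocalFrobenioidOfEmb_descendBijective_of_lifts_of_geom_slim
    [SecondCountableTopology (D.PiLoc D.PiXarrow (localToGF F k ι))] (hΔ : IsSlimGroup D.DeltaC)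
    (he : letI := GaloisValDatum.normVal k
      CatIsomorphism.HasUnder (D.goodLocalFrobenioidOfEmb p k ι hX).toBase (D.goodLocalFrobenioidOfEmb p k ι hX).toBase)
    (hu : letI := GaloisValDatum.normVal k
      CatIsomorphism.UnderUnique (D.goodLocalFrobenioidOfEmb p k ι hX).toBase (D.goodLocalFrobenioidOfEmb p k ι hX).toBase)
    (hlift : letI := GaloisValDatum.normVal k
      ∀ Θ : CosetCat (D.PiLoc D.PiXarrow (localToGF F k ι)) ≌ CosetCat (D.PiLoc D.PiXarrow (localToGF F k ι)),
      ∃ Ψ : (D.goodLocalFrobenioidOfEmb p k ι hX).Cv ≌ (D.goodLocalFrobenioidOfEmb p k ι hX).Cv,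
        Nonempty (CatIsomorphism.LiesUnder (D.goodLocalFrobenioidOfEmb p k ι hX).toBase
          (D.goodLocalFrobenioidOfEmb p k ι hX).toBase Ψ Θ)) :
    letI := GaloisValDatum.normVal k
    CatIsomorphism.DescendBijective (D.goodLocalFrobenioidOfEmb p k ι hX).toBase (D.goodLocalFrobenioidOfEmb p k ι hX).toBase he hu :=
  ⟨goodLocalFrobenioidOfEmb_descend_injective_of_geom_slim' D p k ι hX hΔ he hu,
    CatIsomorphism.descend_surjective_of_lifts _ _ hlift⟩

end GenuinePlace

end Cor53

/-! ### §4. Galois-countability of `Π_v̲` BY NAME: `Gal(k̄/k)` is Galois-countable for every `k/ℚ_p` finite ([IUTchI] Rmk. 2.5.3 (ii)) -/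

namespace GaloisValDatum

variable (p : ℕ) [Fact p.Prime] (k : Type) [NontriviallyNormedField k] [NormedAlgebra ℚ_[p] k] [FiniteDimensional ℚ_[p] k]

include p in
/-- **`G_v = Gal(k̄/k)` is Galois-countable for EVERY `k` finite over `ℚ_p`** (no density hypothesis, unlike
`InitialThetaData.secondCountableTopology_galLoc`): `ψ_e : Gal(k̄/k) ↪ G_{ℚ_p}`, `σ ↦ e σ e⁻¹` (any `e : k̄ ≅ ℚ̄_p`, ★ p510148), is a
closed embedding into the Galois-countable `G_{ℚ_p}` (`QuasiTemperoid.secondCountableTopology_galFbar_padic`; [IUTchI] Rmk. 2.5.3 (ii) (E1)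
«topological subquotients of absolute Galois groups of fields of countable cardinality are Galois-countable»).
([IUTchI] Rmk 2.5.3 (ii) p.53) [claim: Mochizuki2012, status: disputed] -/
theorem secondCountableTopology_gal_ofComplete : SecondCountableTopology (AlgebraicClosure k ≃ₐ[k] AlgebraicClosure k) := by
  obtain ⟨e⟩ := nonempty_algEquiv_padicAlgCl p k
  haveI := charZero p k
  haveI : IsGalois k (AlgebraicClosure k) := {}
  haveI : Algebra.IsIntegral ℚ_[p] (Fbar ℚ_[p]) := Algebra.isAlgebraic_iff_isIntegral.mp inferInstance
  haveI : T2Space (GalFbar ℚ_[p]) := krullTopology_t2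
  haveI := secondCountableTopology_galFbar_padic p
  exact ((continuous_autCongr_restrictScalars p k e).isClosedEmbedding
    (autCongr_restrictScalars_injective p k e)).isEmbedding.secondCountableTopology

end GaloisValDatum

namespace InitialThetaData

universe uF vK

variable {F : Type uF} {K : Type vK} {Fbar : Type} [Field F] [NumberField F] [Field K] [NumberField K]
  [Algebra F K] [Field Fbar] [Algebra F Fbar] [Algebra K Fbar] [IsScalarTower F K Fbar] [Normal K Fbar]
  {E : WeierstrassCurve F} [E.IsElliptic] {l : ℕ} {Pb : BadPlacePredicates K}
  (D : InitialThetaData F K Fbar E l Pb) (p : ℕ) [Fact p.Prime]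
  (k : Type) [NontriviallyNormedField k] [NormedAlgebra ℚ_[p] k] [FiniteDimensional ℚ_[p] k] [Algebra K k]
  (ι : Fbar →ₐ[K] AlgebraicClosure k)

include p in
/-- **`Π_v̲ := Π_{X̲→_v̲}` is Galois-countable as soon as `Π_{C_F}` is** (no density hypothesis on `K ⊆ k`): a subgroup of
`Π_{C_F} × Gal(k̄/k)` with `Gal(k̄/k)` Galois-countable (`GaloisValDatum.secondCountableTopology_gal_ofComplete`).
([IUTchI] Rmk 2.5.3 (ii) p.53) [claim: Mochizuki2012, status: disputed] -/
theorem secondCountableTopology_PiLoc_PiXarrow_of_PiC [SecondCountableTopology D.PiC] :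
    SecondCountableTopology (D.PiLoc D.PiXarrow (localToGF F k ι)) := by
  haveI := GaloisValDatum.secondCountableTopology_gal_ofComplete p k
  exact (inferInstance : SecondCountableTopology
    ((D.PiLoc D.PiXarrow (localToGF F k ι) : Set (D.PiC × (AlgebraicClosure k ≃ₐ[k] AlgebraicClosure k)))))

include p in
/-- … hence modulo the frozen FACT (E2) `Rmk253.TameGaloisCountable D.geom.extF` (F-1979) BY NAME (abc-iut-L5's
`secondCountableTopology_PiC_of_tameGaloisCountable`: (E2) composed with (E1) for the countable field `F`).
([IUTchI] Rmk 2.5.3 (ii) p.53) [claim: Mochizuki2012, status: disputed] -/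
theorem secondCountableTopology_PiLoc_PiXarrow_of_tameGaloisCountable (h : Rmk253.TameGaloisCountable D.geom.extF) :
    SecondCountableTopology (D.PiLoc D.PiXarrow (localToGF F k ι)) := by
  haveI := D.secondCountableTopology_PiC_of_tameGaloisCountable h
  exact D.secondCountableTopology_PiLoc_PiXarrow_of_PiC p k ι

end InitialThetaData

namespace Cor53

section GenuinePlaceFacts

universe uF vK

variable {F : Type uF} {K : Type vK} {Fbar : Type} [Field F] [NumberField F] [Field K] [NumberField K]
  [Algebra F K] [Field Fbar] [Algebra F Fbar] [Algebra K Fbar] [IsScalarTower F K Fbar] [Normal K Fbar]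
  {E : WeierstrassCurve F} [E.IsElliptic] {l : ℕ} {Pb : BadPlacePredicates K}
  (D : InitialThetaData F K Fbar E l Pb) (p : ℕ) [Fact p.Prime]
  (k : Type) [NontriviallyNormedField k] [CompleteSpace k] [IsUltrametricDist k] [NormedAlgebra ℚ_[p] k]
  [FiniteDimensional ℚ_[p] k] [Algebra K k] (ι : Fbar →ₐ[K] AlgebraicClosure k) (hX : IsOpen (D.PiXarrow : Set D.PiC))

/-- **Injectivity at the genuine place with the cell-standard side binder `[SecondCountableTopology Π_{C_F}]`** (as in abc-iut-L5's
`ddashFromD_goodLocalFrobenioidOfEmb_of_forall_map_ker`) in place of `[SecondCountableTopology Π_v̲]`, modulo F-0004 (1).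
Binder census: FACT-input {`IsSlimGroup D.DeltaC`} · side {`SecondCountableTopology D.PiC`} · binders {he, hu} · LAW ∅.
([IUTchI] Cor 5.3 (ii) p.144) [claim: Mochizuki2012, status: disputed] -/
theorem goodLocalFrobenioidOfEmb_descend_injective_of_geom_slim_of_PiC [SecondCountableTopology D.PiC]
    (hΔ : IsSlimGroup D.DeltaC)
    (he : letI := GaloisValDatum.normVal k
      CatIsomorphism.HasUnder (D.goodLocalFrobenioidOfEmb p k ι hX).toBase (D.goodLocalFrobenioidOfEmb p k ι hX).toBase)
    (hu : letI := GaloisValDatum.normVal k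
      CatIsomorphism.UnderUnique (D.goodLocalFrobenioidOfEmb p k ι hX).toBase (D.goodLocalFrobenioidOfEmb p k ι hX).toBase) :
    Function.Injective (CatIsomorphism.descend he hu) := by
  haveI := D.secondCountableTopology_PiLoc_PiXarrow_of_PiC p k ι
  exact goodLocalFrobenioidOfEmb_descend_injective_of_geom_slim' D p k ι hX hΔ he hu

/-- **[IUTchI] Cor 5.3 (ii), model case, INJECTIVITY at the GENUINE good place — modulo the frozen FACTS ONLY**: (E2)
`Rmk253.TameGaloisCountable D.geom.extF` (F-1979, Galois-countability of `Π_{C_F}`) and `GeomAndArithSlim D.geom.extF` (F-0004,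
[AbsAnab] Lem. 1.3.1; first conjunct used), for EVERY choice of the §0 binders `he`/`hu`.  Binder census: FACT {F-1979, F-0004} ·
binders {he, hu} (inhabited) · DATA {D, p, k, ι, hX} · LAW ∅ · side ∅. ([IUTchI] Cor 5.3 (ii) p.144) [claim: Mochizuki2012, status: disputed] -/
theorem goodLocalFrobenioidOfEmb_descend_injective_of_facts (hE2 : Rmk253.TameGaloisCountable D.geom.extF)
    (h : Literature.AnabelianGeometry.AbsoluteAnabelian.FundamentalExtension.GeomAndArithSlim D.geom.extF)
    (he : letI := GaloisValDatum.normVal k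
      CatIsomorphism.HasUnder (D.goodLocalFrobenioidOfEmb p k ι hX).toBase (D.goodLocalFrobenioidOfEmb p k ι hX).toBase)
    (hu : letI := GaloisValDatum.normVal k
      CatIsomorphism.UnderUnique (D.goodLocalFrobenioidOfEmb p k ι hX).toBase (D.goodLocalFrobenioidOfEmb p k ι hX).toBase) :
    Function.Injective (CatIsomorphism.descend he hu) := by
  haveI := D.secondCountableTopology_PiC_of_tameGaloisCountable hE2
  exact goodLocalFrobenioidOfEmb_descend_injective_of_geom_slim_of_PiC D p k ι hX h.1 he hu

/-- **[IUTchI] Cor 5.3 (ii), model case AS PRINTED («bijective») at the GENUINE good place — modulo the frozen FACTS {F-1979, F-0004}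
(injectivity) + FACT {hlift} (surjectivity, BY NAME)**, for every choice of `he`/`hu`.  Binder census: FACT {F-1979, F-0004, hlift} ·
binders {he, hu} · DATA {D, p, k, ι, hX} · LAW ∅ · side ∅. ([IUTchI] Cor 5.3 (ii) p.144) [claim: Mochizuki2012, status: disputed] -/
theorem goodLocalFrobenioidOfEmb_descendBijective_of_lifts_of_facts (hE2 : Rmk253.TameGaloisCountable D.geom.extF)
    (h : Literature.AnabelianGeometry.AbsoluteAnabelian.FundamentalExtension.GeomAndArithSlim D.geom.extF)
    (he : letI := GaloisValDatum.normVal k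
      CatIsomorphism.HasUnder (D.goodLocalFrobenioidOfEmb p k ι hX).toBase (D.goodLocalFrobenioidOfEmb p k ι hX).toBase)
    (hu : letI := GaloisValDatum.normVal k
      CatIsomorphism.UnderUnique (D.goodLocalFrobenioidOfEmb p k ι hX).toBase (D.goodLocalFrobenioidOfEmb p k ι hX).toBase)
    (hlift : letI := GaloisValDatum.normVal k
      ∀ Θ : CosetCat (D.PiLoc D.PiXarrow (localToGF F k ι)) ≌ CosetCat (D.PiLoc D.PiXarrow (localToGF F k ι)),
      ∃ Ψ : (D.goodLocalFrobenioidOfEmb p k ι hX).Cv ≌ (D.goodLocalFrobenioidOfEmb p k ι hX).Cv,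
        Nonempty (CatIsomorphism.LiesUnder (D.goodLocalFrobenioidOfEmb p k ι hX).toBase
          (D.goodLocalFrobenioidOfEmb p k ι hX).toBase Ψ Θ)) :
    letI := GaloisValDatum.normVal k
    CatIsomorphism.DescendBijective (D.goodLocalFrobenioidOfEmb p k ι hX).toBase (D.goodLocalFrobenioidOfEmb p k ι hX).toBase he hu :=
  ⟨goodLocalFrobenioidOfEmb_descend_injective_of_facts D p k ι hX hE2 h he hu,
    CatIsomorphism.descend_surjective_of_lifts _ _ hlift⟩

end GenuinePlaceFacts

end Cor53

end Literature.IUT.HodgeTheaters
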